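import Summits.BirchSwinnertonDyer.BirchSwinnertonDyer.Theorems.GenusKolyvaginAtTwoOffCutResidualAtTwoRLw2TateWitnessLocal
import Summits.BirchSwinnertonDyer.BirchSwinnertonDyer.Theorems.GenusKolyvaginAtTwoOffCutResidualAtTwoRLw2PhantomExclusionCut
import HarnessLib

/-!
# Route `GenusKolyvaginAtTwo`, residual `OffCutResidualAtTwoR` (stmt-BirchSwinnertonDyer-31767), LINE 26 «lw2_phantom_exclusion» /
# LINE 33–34 F4′: THE TATE WITNESS AT A MULTIPLICATIVE PLACE OF ANY RESIDUE CHARACTERISTIC — part 3, the NON-PHANTOM LEMMA at `v ∣ 2`,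
# the LEVEL-2 WITNESS over `ℚ` at ANY multiplicative place, and `(NPh)` for every habitat curve with a multiplicative prime

Width seat `bsd-line-gk2-p5` g41 (cell `bsd-f1-sign2`), `--supports stmt-BirchSwinnertonDyer-31767 --as helper`.  THEOREMS ONLY (no definition,
no named fact, no `sorry`).  **BSD is NOT proved by this file; nothing is closed by it.**

WHAT (all places of multiplicative reduction, residue characteristic `2` INCLUDED; the tree's versions carry `v ∤ 2`):
* `TateFour.exists_tateWitness_geomTorsion` — part 2's `τ ∈ Γ_{K_v}` read on `E[4] = geomTorsion W 4` along the chosen `K̄ → K̄_v`: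
  `res τ` unipotent on `E[4]`, moving `E[2]`, and principal on the chosen cocycle of every class of `H¹(K, E[4])` Kummer at `v`.
* ★ `TateFour.eq_zero_of_h1Eval_eq_zero_of_mem_selmerLocalKer_tate` — THE NON-PHANTOM LEMMA without `v ∤ 2`: `ρ̄_{E,4}` onto, `v` multiplicative with
  `ord_v Δ_min` odd, `x ∈ H¹(K, E[4])` a phantom and Kummer at `v` ⟹ `x = 0` (the tree's `H¹(GL₂(ℤ/4),(ℤ/4)²) ↪ H¹(⟨τ⟩, ·)`,
  `eq_zero_of_h1Eval_eq_zero_of_unipotent`); `hres_of_mem_selmerLocalKer_tate` (the pair-Čebotarev currency).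
* ★ `Lw2PhantomExclusion.levelTwoWitness_rat_of_hasMultiplicativeReductionAt_tate` / `…_anyPlace` — over `ℚ`: `ρ̄_{2^n}` onto, `Odd (∏ c_p)`, `v` ANY
  multiplicative place (the place `2` allowed): no non-zero class of `H¹(ℚ, E[2])` dying on `Γ_{ℚ(E[4])}` is Kummer at `ℚ_v` — LINE 26's instrument row
  «multiplicative at 2: 17/17 witness at v = 2» is now a THEOREM.
* `exists_levelTwoWitness_rat_of_exists_multiplicative` — `LW₂(W)` (the `hLW` clause of LINE 26's `OffCutResidualAtTwoR_of`) for every habitat curve with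
  A multiplicative prime, odd or `2`: **`j(E) ∉ ℤ` ⟹ `LW₂(W)`**.
* `nonPhantom_baseChange_of_exists_multiplicative` — `(NPh_M)` for every `M ≥ 1` on every Heegner frame of such a curve (LINE 26 binders; = the
  statement of LINE 33/34's F4′ `stub_offCutNonPhantom` on the `2`-multiplicative slice of the off-cut K₄± cells, with the weaker `2N`-local Kummer
  hypothesis), via gk2-p4 g31's transport (p781093) and KLW (p780467) BY NAME.  READING for the pen: on the habitat the `(NPh)`-fed engine reaches exactly
  the curves with NON-INTEGRAL `j`-invariant; the `(NPh)`-residual of LINE 26 / F4′ is the integral-`j` slice (all bad primes additive, potentially good),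
  where odd additive primes are silent (`…NonPhantomAdditive`) and only the places over `2` remain.

References: [LawsonWuthrich2016] §7.1, §8; [SilvermanATAEC1994] Thm. V.3.1, Lemma V.5.2, Thm. V.5.3, proof of Prop. V.6.1 (PDF pp. 395–411), Cor. IV.9.2 (d);
[SilvermanAEC2009] X.§4 (proof of Thm. 4.2 (b)), Cor. III.6.4 (b); [GrossLMS1991] §9 Prop. 9.1; [McCallumLMS1991] §4 (5).
-/

set_option linter.dupNamespace false -- tree convention: `Summit.BirchSwinnertonDyer.BirchSwinnertonDyer.Theorems` (summit = sub-problem)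
set_option autoImplicit false

noncomputable section

open scoped Classical
open Field NumberField IsDedekindDomain WeierstrassCurve

namespace Summit.BirchSwinnertonDyer.BirchSwinnertonDyer.Theorems.GenusExact.NonPhantom.TateFour

open Literature.NumberTheory.EllipticCurves Literature.NumberTheory.EllipticCurves.TateCurve
  Literature.NumberTheory.GaloisRepresentations SteinWuthrich2013

variable {K : Type} [Field K] [NumberField K] (W : WeierstrassCurve K) (v : HeightOneSpectrum (𝓞 K))

/-- **THE TATE WITNESS read on `E[4] = geomTorsion W 4` and on `H¹(K, E[4])`** (global form along the chosen embedding
`K̄ → K̄_v`): at a multiplicative place `v` (any residue characteristic) with `ord_v Δ_min` odd there is `τ ∈ Γ_{K_v}` whose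
restriction `res τ ∈ Γ_K` (i) is unipotent on `E[4]`, (ii) moves a point of `E[2]`, and (iii) on which the chosen cocycle of
every class of `H¹(K, E[4])` satisfying the local KUMMER condition at `v` is principal: `[x, res τ] = res τ • m − m`.
[cite: SilvermanATAEC1994, Thm. V.3.1 (c),(d), V.5.2 (c), Thm. V.5.3, proof of Prop. V.6.1 (PDF pp. 395–411)]
[cite: SilvermanAEC2009, X.§4 proof of Thm. 4.2 (b), Cor. III.6.4 (b)] -/
theorem exists_tateWitness_geomTorsion [W.IsElliptic] (hmult : W.HasMultiplicativeReductionAt v)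
    (hodd : Odd (W.ordMinimalDiscriminant v)) {n : ℤ} (hn : n = 4) :
    ∃ τ : absoluteGaloisGroup (v.adicCompletion K),
      (∀ P : geomTorsion W n, resGal (K := K) (v.adicCompletion K) τ •
          (resGal (K := K) (v.adicCompletion K) τ • P - P) = resGal (K := K) (v.adicCompletion K) τ • P - P) ∧
      (∃ Q : geomTorsion W n, (2 : ℤ) • Q = 0 ∧ resGal (K := K) (v.adicCompletion K) τ • Q ≠ Q) ∧
      (∀ x : galH1Torsion W n, x ∈ selmerLocalKer W (v.adicCompletion K) n →
        ∃ m : geomTorsion W n, h1Eval W n x (resGal (K := K) (v.adicCompletion K) τ) =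
          resGal (K := K) (v.adicCompletion K) τ • m - m) := by
  subst hn
  haveI : CharZero K := inferInstance
  obtain ⟨τ, hunip, ⟨P₂, hP₂, hmove⟩, hprinc⟩ := exists_tateWitness_localPoints W v hmult hodd
  have hinj : Function.Injective (pointsMap W (v.adicCompletion K)) := pointsMapOfEmb_injective W _
  refine ⟨τ, fun P ↦ ?_, ?_, fun x hx ↦ ?_⟩
  · -- (i) unipotency, read in `W(K̄_v)`
    have hP4 : (4 : ℤ) • pointsMap W (v.adicCompletion K) (P : geomPoints W) = 0 := by
      rw [← map_zsmul, (Submodule.mem_torsionBy_iff _ _).mp P.2, map_zero]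
    apply Subtype.ext
    simp only [AddSubgroupClass.coe_sub, Literature.NumberTheory.EllipticCurves.AddSubgroup.torsionBy.coe_smul]
    apply hinj
    simp only [map_sub, pointsMap_smul]
    exact hunip _ hP4
  · -- (ii) the moved `2`-torsion point is algebraic
    have hP₂' : (2 : ℕ) • P₂ = 0 := by rw [← natCast_zsmul]; exact hP₂
    obtain ⟨P₀, h2P₀, hP₀⟩ := exists_pointsMapOfEmb_eq_of_nsmul_eq_zero W
      (closureEmb (K := K) (v.adicCompletion K)) two_ne_zero hP₂'
    have hmem : P₀ ∈ geomTorsion W (4 : ℤ) := by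
      refine (Submodule.mem_torsionBy_iff _ _).mpr ?_
      change (4 : ℤ) • P₀ = 0
      rw [show (4 : ℤ) = (2 : ℤ) * 2 by norm_num, mul_smul, show (2 : ℤ) • P₀ = (2 : ℕ) • P₀ from
        (natCast_zsmul P₀ 2).symm, h2P₀, smul_zero]
    refine ⟨⟨P₀, hmem⟩, Subtype.ext ?_, fun h ↦ hmove ?_⟩
    · change (2 : ℤ) • P₀ = 0
      rw [show (2 : ℤ) • P₀ = (2 : ℕ) • P₀ from (natCast_zsmul P₀ 2).symm, h2P₀]
    · have h' := congrArg (fun R : geomTorsion W (4 : ℤ) ↦ pointsMap W (v.adicCompletion K) (R : geomPoints W)) h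
      simp only [Literature.NumberTheory.EllipticCurves.AddSubgroup.torsionBy.coe_smul, pointsMap_smul] at h'
      change τ • pointsMapOfEmb W (closureEmb (K := K) (v.adicCompletion K)) P₀ =
        pointsMapOfEmb W (closureEmb (K := K) (v.adicCompletion K)) P₀ at h'
      rwa [hP₀] at h'
  · -- (iii) principality of the chosen cocycle of a Kummer class on `res τ`
    have hx' : oneCocycleClass _ (reprCocycle W (4 : ℤ) x) ∈ selmerLocalKer W (v.adicCompletion K) (4 : ℤ) := by
      rwa [oneCocycleClass_reprCocycle]
    obtain ⟨P, hP⟩ := (oneCocycleClass_mem_resKer_iff _ _ _ (reprCocycle W (4 : ℤ) x)).mp hx'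
    have hP' : ∀ σ : absoluteGaloisGroup (v.adicCompletion K),
        pointsMap W (v.adicCompletion K)
          (((reprCocycle W (4 : ℤ) x).1 (resGal (K := K) (v.adicCompletion K) σ) : geomTorsion W (4 : ℤ)) :
            geomPoints W) = σ • P - P := fun σ ↦ hP σ
    -- `4 • P` is `Γ_{K_v}`-fixed
    have h4P : ∀ σ : absoluteGaloisGroup (v.adicCompletion K), σ • ((4 : ℤ) • P) = (4 : ℤ) • P := by
      intro σ
      have h0 : ((4 : ℤ) • (((reprCocycle W (4 : ℤ) x).1 (resGal (K := K) (v.adicCompletion K) σ) :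
          geomTorsion W (4 : ℤ)) : geomPoints W)) = 0 :=
        (Submodule.mem_torsionBy_iff (4 : ℤ) _).mp ((reprCocycle W (4 : ℤ) x).1 _).2
      have h1 : (4 : ℤ) • (σ • P - P) = 0 := by rw [← hP' σ, ← map_zsmul, h0, map_zero]
      rw [zsmul_sub, ← smul_zsmul_localPoints, sub_eq_zero] at h1
      exact h1
    obtain ⟨M, hM4, hM⟩ := hprinc P h4P
    -- `M ∈ E[4]` comes from `E(K̄)`
    have hM4' : (4 : ℕ) • M = 0 := by rw [← natCast_zsmul]; exact hM4
    obtain ⟨m₀, hm₀n, hm₀⟩ :=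
      exists_pointsMapOfEmb_eq_of_nsmul_eq_zero W (closureEmb (K := K) (v.adicCompletion K)) four_ne_zero hM4'
    refine ⟨⟨m₀, (mem_geomTorsion_iff W (4 : ℤ) m₀).mpr (by
      rw [show (4 : ℤ) • m₀ = (4 : ℕ) • m₀ from (natCast_zsmul m₀ 4).symm, hm₀n])⟩, Subtype.ext ?_⟩
    apply hinj
    change pointsMap W (v.adicCompletion K)
        (((reprCocycle W (4 : ℤ) x).1 (resGal (K := K) (v.adicCompletion K) τ) : geomTorsion W (4 : ℤ)) :
          geomPoints W) = pointsMap W (v.adicCompletion K) _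
    rw [hP' τ, AddSubgroupClass.coe_sub, Literature.NumberTheory.EllipticCurves.AddSubgroup.torsionBy.coe_smul,
      map_sub, pointsMap_smul]
    change τ • P - P = τ • pointsMapOfEmb W (closureEmb (K := K) (v.adicCompletion K)) m₀ -
      pointsMapOfEmb W (closureEmb (K := K) (v.adicCompletion K)) m₀
    rw [hm₀, hM]

/-- **THE NON-PHANTOM LEMMA at a multiplicative place of ANY residue characteristic** (`v ∣ 2` allowed).  `E/K` elliptic over a
number field with `ρ̄_{E,4}` onto, `v` a place of MULTIPLICATIVE reduction with `ord_v Δ_min` ODD.  A class `x ∈ H¹(K, E[4])` which is a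
PHANTOM (`[x, ρ] = 0` for `ρ ∈ Γ_{K(E[4])}`) and satisfies the local Kummer (Selmer) condition at `v` is ZERO.  This is gk2-p3 g22's
`NonPhantom.eq_zero_of_h1Eval_eq_zero_of_mem_selmerLocalKer` WITHOUT its hypothesis `v ∤ 2`: the transvection and the principality come
from Tate's uniformisation (`exists_tateWitness_geomTorsion`) instead of from the inertia group (which at `v ∣ 2` only supplies `u²`), and
`H¹(GL₂(ℤ/4), (ℤ/4)²) → H¹(⟨τ⟩, ·)` is injective (`eq_zero_of_h1Eval_eq_zero_of_unipotent`).  In particular the Lawson–Wuthrich phantom is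
NOT Kummer at a `2`-adic multiplicative place with odd `ord_2 Δ`.
[cite: LawsonWuthrich2016, §7.1 and §8] [cite: SilvermanATAEC1994, proof of Prop. V.6.1, Thm. V.5.3 (PDF pp. 407–411)] -/
theorem eq_zero_of_h1Eval_eq_zero_of_mem_selmerLocalKer_tate [W.IsElliptic]
    (hmult : W.HasMultiplicativeReductionAt v) (hodd : Odd (W.ordMinimalDiscriminant v)) {n : ℤ} (hn : n = 4)
    (hρ : W.HasSurjectiveModNGaloisRep n) {x : galH1Torsion W n} (hx : ∀ ρ ∈ torsionFixing W n, h1Eval W n x ρ = 0)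
    (hxv : x ∈ selmerLocalKer W (v.adicCompletion K) n) : x = 0 := by
  obtain ⟨τ, hu₁, hu₂, hprinc⟩ := exists_tateWitness_geomTorsion W v hmult hodd hn
  exact eq_zero_of_h1Eval_eq_zero_of_unipotent W hn hρ hu₁ hu₂ hx (hprinc x hxv)

/-- **The separation hypothesis `hres` for classes Kummer at such a place**: no non-zero `a • c + b • y` with `c, y` Kummer at `v` is a
phantom (the `hres` currency of the pair Čebotarev / bottom-rung engines), now at a multiplicative place of any residue characteristic.
[cite: LawsonWuthrich2016, §7.1 and §8] -/
theorem hres_of_mem_selmerLocalKer_tate [W.IsElliptic]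
    (hmult : W.HasMultiplicativeReductionAt v) (hodd : Odd (W.ordMinimalDiscriminant v)) {n : ℤ} (hn : n = 4)
    (hρ : W.HasSurjectiveModNGaloisRep n) {c y : galH1Torsion W n} (hc : c ∈ selmerLocalKer W (v.adicCompletion K) n)
    (hy : y ∈ selmerLocalKer W (v.adicCompletion K) n) :
    ∀ a b : ℤ, (∀ ρ ∈ torsionFixing W n, h1Eval W n (a • c + b • y) ρ = 0) → a • c + b • y = 0 :=
  fun a b hab ↦ eq_zero_of_h1Eval_eq_zero_of_mem_selmerLocalKer_tate W v hmult hodd hn hρ hab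
    ((selmerLocalKer W _ n).add_mem ((selmerLocalKer W _ n).zsmul_mem hc a) ((selmerLocalKer W _ n).zsmul_mem hy b))

end Summit.BirchSwinnertonDyer.BirchSwinnertonDyer.Theorems.GenusExact.NonPhantom.TateFour

/-! ## Over `ℚ`: the level-2 witness at ANY multiplicative place; LINE 26's `LW₂(W)` and `(NPh)` for curves with a multiplicative prime -/

namespace Summit.BirchSwinnertonDyer.BirchSwinnertonDyer.Theorems.GenusExact.Lw2PhantomExclusion

open WeierstrassCurve NumberField Field IsDedekindDomain
open Literature.NumberTheory.EllipticCurves Literature.NumberTheory.GaloisRepresentations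
open Summit.BirchSwinnertonDyer.BirchSwinnertonDyer.Theorems.GenusExact.NonPhantom.TateFour
  (eq_zero_of_h1Eval_eq_zero_of_mem_selmerLocalKer_tate)

variable (W : WeierstrassCurve ℚ) [W.IsElliptic]

/-- ★ **A MULTIPLICATIVE PLACE OF ANY RESIDUE CHARACTERISTIC IS A LEVEL-2 WITNESS.**  `E/ℚ` elliptic with `ρ̄_{E,2}`, `ρ̄_{E,4}` onto, `v` a place of
multiplicative reduction (the place `2` allowed) with `ord_v Δ_min` odd: no non-zero class of `H¹(ℚ, E[2])` dying on `Γ_{ℚ(E[4])}` satisfies the Kummer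
(Selmer) condition at `ℚ_v`.  The proof of gk2-p4 g31's `levelTwoWitness_rat_of_hasMultiplicativeReductionAt_of_odd` verbatim, with the Tate-witness
non-phantom lemma in place of the inertial one. [cite: LawsonWuthrich2016, §7.1 and §8] [cite: SilvermanATAEC1994, proof of Prop. V.6.1 (PDF p. 411)] -/
theorem levelTwoWitness_rat_of_hasMultiplicativeReductionAt_tate
    (hρ2 : W.HasSurjectiveModNGaloisRep 2) (hρ4 : W.HasSurjectiveModNGaloisRep 4)
    {v : HeightOneSpectrum (𝓞 ℚ)} (hmult : W.HasMultiplicativeReductionAt v) (hodd : Odd (W.ordMinimalDiscriminant v)) :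
    ∀ z : galH1Torsion W 2, z ≠ 0 → (∀ ρ ∈ torsionFixing W 4, h1Eval W 2 z ρ = 0) →
      z ∉ selmerLocalKer W (v.adicCompletion ℚ) 2 := by
  intro z hz0 hz hzv
  have h12 : (2 : ℤ) ∣ ((2 ^ 2 : ℕ) : ℤ) := ⟨2, by norm_num⟩
  have hinj : Function.Injective (torsionH1OfDvd W h12) :=
    VisiblePairAtTwo.torsionH1OfDvd_pow_injective W (p := 2) (a := 1) (j := 2)
      (VisiblePairAtTwo.torsionBy_two_eq_bot_of_surj W hρ2) _
  have hρ4' : W.HasSurjectiveModNGaloisRep ((2 ^ 2 : ℕ) : ℤ) := by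
    have e : ((2 ^ 2 : ℕ) : ℤ) = 4 := by norm_num
    rw [e]
    exact hρ4
  have hz4 : ∀ ρ ∈ torsionFixing W ((2 ^ 2 : ℕ) : ℤ), h1Eval W (2 : ℤ) z ρ = 0 := by
    have e : ((2 ^ 2 : ℕ) : ℤ) = 4 := by norm_num
    rw [e]
    exact hz
  have hιz : ∀ ρ ∈ torsionFixing W ((2 ^ 2 : ℕ) : ℤ), h1Eval W _ (torsionH1OfDvd W h12 z) ρ = 0 :=
    fun ρ hρ' ↦ (h1Eval_torsionH1OfDvd_eq_zero_iff W h12 z hρ').mpr (hz4 ρ hρ')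
  have hιv : torsionH1OfDvd W h12 z ∈ selmerLocalKer W (v.adicCompletion ℚ) ((2 ^ 2 : ℕ) : ℤ) :=
    (RelaxedCount.torsionH1OfDvd_mem_selmerLocalKer_iff_mem W h12 (v.adicCompletion ℚ) z).mpr hzv
  have hι0 : torsionH1OfDvd W h12 z = 0 :=
    eq_zero_of_h1Eval_eq_zero_of_mem_selmerLocalKer_tate W v hmult hodd (n := ((2 ^ 2 : ℕ) : ℤ)) (by norm_num)
      hρ4' hιz hιv
  exact hz0 (hinj (by rw [hι0, map_zero]))

/-- ★ **Habitat form**: `E/ℚ` elliptic with `Odd (∏ c_p)` (so `ord_v Δ_min` is odd at every multiplicative `v`, the place `2` included: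
`NonPhantom.odd_ordMinimalDiscriminant_of_odd_tamagawaProduct`) and `ρ̄_{E,2^n}` onto for all `n ≥ 1`; `v` ANY multiplicative place: no non-zero class
of `H¹(ℚ, E[2])` dying on `Γ_{ℚ(E[4])}` is Kummer at `ℚ_v`.  For `v = 2` this is LINE 26's instrument row «multiplicative at 2: 17/17 witness at 2» as a
THEOREM. [cite: LawsonWuthrich2016, §7.1 and §8] [cite: SilvermanATAEC1994, Cor. IV.9.2 (d), proof of Prop. V.6.1] -/
theorem levelTwoWitness_rat_of_hasMultiplicativeReductionAt_anyPlace
    (hT : Odd W.tamagawaProduct) (hρ : ∀ n : ℕ, 0 < n → W.HasSurjectiveModNGaloisRep ((2 : ℤ) ^ n))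
    {v : HeightOneSpectrum (𝓞 ℚ)} (hmult : W.HasMultiplicativeReductionAt v) :
    ∀ z : galH1Torsion W 2, z ≠ 0 → (∀ ρ ∈ torsionFixing W 4, h1Eval W 2 z ρ = 0) →
      z ∉ selmerLocalKer W (v.adicCompletion ℚ) 2 := by
  have hρ2 : W.HasSurjectiveModNGaloisRep 2 := by simpa using hρ 1 one_pos
  have hρ4 : W.HasSurjectiveModNGaloisRep 4 := by have h := hρ 2 two_pos; norm_num at h; exact h
  exact levelTwoWitness_rat_of_hasMultiplicativeReductionAt_tate W hρ2 hρ4 hmult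
    (NonPhantom.odd_ordMinimalDiscriminant_of_odd_tamagawaProduct W hT hmult)

/-- **`LW₂(W)` for every habitat curve with A multiplicative prime (odd OR `2`)**, in the exact shape of the `hLW` clause of LINE 26's composition
`OffCutResidualAtTwoR_of`: `∃ v ∋ N` at which no non-zero level-4 phantom of `H¹(ℚ, E[2])` is Kummer.  The cut (`v` odd multiplicative,
`exists_levelTwoWitness_rat_of_cut`) and the `2`-multiplicative slice of the residual `R₂` are the two cases; together: **`j(E) ∉ ℤ` ⟹ `LW₂(W)`** on
the habitat. [cite: LawsonWuthrich2016, §7.1 and §8] -/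
theorem exists_levelTwoWitness_rat_of_exists_multiplicative [W.IsGloballyMinimal]
    (hT : Odd W.tamagawaProduct) (hρ : ∀ n : ℕ, 0 < n → W.HasSurjectiveModNGaloisRep ((2 : ℤ) ^ n))
    (hmv : ∃ v : HeightOneSpectrum (𝓞 ℚ), ((W.conductorNorm ℤ : ℕ) : 𝓞 ℚ) ∈ v.asIdeal ∧ W.HasMultiplicativeReductionAt v) :
    ∃ v : HeightOneSpectrum (𝓞 ℚ), ((W.conductorNorm ℤ : ℕ) : 𝓞 ℚ) ∈ v.asIdeal ∧
      (∀ z : galH1Torsion W 2, z ≠ 0 → (∀ ρ ∈ torsionFixing W 4, h1Eval W 2 z ρ = 0) →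
        z ∉ selmerLocalKer W (v.adicCompletion ℚ) 2) := by
  obtain ⟨v, hNv, hmult⟩ := hmv
  exact ⟨v, hNv, levelTwoWitness_rat_of_hasMultiplicativeReductionAt_anyPlace W hT hρ hmult⟩

/-- **`(NPh_M)` for every `M ≥ 1` on every Heegner frame of a habitat curve with A multiplicative prime (odd OR `2`)** — the binders of the LINE 26
skeleton (= those of LINE 33/34's F4′ `stub_offCutNonPhantom` up to the `2N`-restriction of the Kummer hypothesis, which is WEAKER here): multiplicative
prime ⟹ `LW₂(W)` ⟹ (gk2-p4 `levelTwoWitness_baseChange_of_rat`, Heegner transport: `v ∣ N` is split in `K`) a `K`-witness at `w₀ ∋ 2N` ⟹ (gk2-p4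
`nonPhantom_baseChange_of_levelTwoWitness` = `stub_KLW`) `(NPh_M)`.  So on the habitat the `(NPh)`-fed engine reaches every curve with non-integral
`j`-invariant; the residual of LINE 26 / F4′ is the INTEGRAL-`j` slice (every bad prime additive, potentially good).  BSD is NOT proved by this.
[cite: LawsonWuthrich2016, §7.1 and §8] [cite: GrossLMS1991, §9 Prop. 9.1] -/
theorem nonPhantom_baseChange_of_exists_multiplicative [W.IsGloballyMinimal] [NeZero (W.conductorNorm ℤ)]
    (hT : Odd W.tamagawaProduct) (hρ : ∀ n : ℕ, 0 < n → W.HasSurjectiveModNGaloisRep ((2 : ℤ) ^ n))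
    (K : Type) [Field K] [NumberField K] (hK : IsImaginaryQuadratic K) (hodd : Odd (NumberField.discr K))
    (hH : SatisfiesHeegnerHypothesis (W.conductorNorm ℤ) K)
    (hnsq₁ : ¬ IsSquare ((NumberField.discr K : ℚ) * -|W.Δ|)) (hnsq₂ : ¬ IsSquare ((NumberField.discr K : ℚ) * (-(2 * |W.Δ|))))
    (hmv : ∃ v : HeightOneSpectrum (𝓞 ℚ), ((W.conductorNorm ℤ : ℕ) : 𝓞 ℚ) ∈ v.asIdeal ∧ W.HasMultiplicativeReductionAt v) :
    ∀ (Mlev : ℕ), 1 ≤ Mlev → ∀ z : galH1Torsion (W.baseChange K) ((2 ^ Mlev : ℕ) : ℤ),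
      (∀ ρ ∈ torsionFixing (W.baseChange K) ((2 ^ Mlev : ℕ) : ℤ), h1Eval (W.baseChange K) ((2 ^ Mlev : ℕ) : ℤ) z ρ = 0) →
      (∀ w : HeightOneSpectrum (𝓞 K), ((2 * W.conductorNorm ℤ : ℕ) : 𝓞 K) ∈ w.asIdeal →
        z ∈ selmerLocalKer (W.baseChange K) (w.adicCompletion K) ((2 ^ Mlev : ℕ) : ℤ)) → z = 0 := by
  obtain ⟨w₀, hw₀, hwit⟩ := levelTwoWitness_baseChange_of_rat W hT hρ K hK hodd hH hnsq₁ hnsq₂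
    (exists_levelTwoWitness_rat_of_exists_multiplicative W hT hρ hmv)
  exact nonPhantom_baseChange_of_levelTwoWitness W hT hρ K hK hodd hH hnsq₁ hnsq₂ w₀ hw₀ hwit

end Summit.BirchSwinnertonDyer.BirchSwinnertonDyer.Theorems.GenusExact.Lw2PhantomExclusion

end
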